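import Summits.QuantumFields.QCD.Theorems.PauliWegnerSeaChiralOneScaleTrajectoryStubTransferPositivityObs
import Mathlib.Algebra.QuadraticDiscriminant

/-!
# The `2 × 2` Gram form of site-reflection positivity for smeared pseudoscalar densities
(helper for stub `stub_transferPositivity`, crux `PauliWegnerSea.ChiralOneScaleTrajectory`, stmt-QuantumFields-17512,
line `log-convex-continuum-lift`)

1. **Gram positivity in the complex order** (elementary): if `|α|² a + α β̄ b + β ᾱ c + |β|² d` is a non-negative real
   (Mathlib's `ComplexOrder`: `0 ≤ z ↔ 0 ≤ re z ∧ im z = 0`) for all complex `α, β`, then `a ≥ 0`, `d ≥ 0`, `c = b̄` and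
   `|b|² ≤ (re a)(re d)` (`discrim_le_zero`), with the version rescaled by a fixed `v`, and the normalisation
   `0 ≤ c · conj z ⇒ 0 ≤ (conj c/‖c‖) · z`.
2. **The reflected pairing of two pseudoscalar densities** on the odd torus `2S+1` with antiperiodic Wilson quarks:
   `∫∫ B_fg(x) Θ_T(B_fg(y)) e^{AP} = −∫∫ B_gf(0) B_fg(x − θy) e^{AP}` (`Θ_T(ψ̄_f γ₅ ψ_g)(y) = −(ψ̄_g γ₅ ψ_f)(θy)`, evenness,
   and translation invariance of the un-normalised two-bilinear functional, taken as a HYPOTHESIS), its smeared version,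
   and the smeared Gram form obtained from the landed site-reflection positivity `posConst_mul_conj_integral_nonneg`
   (Montvay–Münster §4.2.3 (4.90)–(4.110); Lüscher 1977; Osterwalder–Seiler 1978) applied to `α X_s + β' X_t`.
-/

noncomputable section

namespace Summit.QuantumFields.QCD.Cruxes.ChiralOneScaleTrajectory.LogConvexLift.TransferPositivity

open scoped BigOperators ComplexOrder ComplexConjugate
open MeasureTheory Filter
open Literature.MathematicalPhysics.QuantumFieldTheory Literature.MathematicalPhysics.QuantumLattice
  Literature.Probability.LatticeModels

variable {Nf : ℕ}

/-! ### Gram positivity in the complex order -/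

section Gram

/-- In a non-negative `2 × 2` Gram form `|α|² a + α β̄ b + β ᾱ c + |β|² d ≥ 0` (all `α β : ℂ`) the
off-diagonal entries are complex conjugate: `c = b̄`. -/
theorem gram_two_conj {a b c d : ℂ}
    (h : ∀ α β : ℂ, 0 ≤ α * conj α * a + α * conj β * b + β * conj α * c + β * conj β * d) :
    c = conj b := by
  have ha := Complex.nonneg_iff.1 (by simpa using h 1 0)
  have hd := Complex.nonneg_iff.1 (by simpa using h 0 1)
  have h11 := Complex.nonneg_iff.1 (h 1 1)
  have h1I := Complex.nonneg_iff.1 (h 1 Complex.I)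
  simp only [map_one, mul_one, one_mul, Complex.conj_I, Complex.add_im, Complex.add_re,
    Complex.mul_im, Complex.mul_re, Complex.I_re, Complex.I_im, Complex.neg_re, Complex.neg_im] at h11 h1I
  apply Complex.ext
  · simp only [Complex.conj_re]
    linarith [h1I.2, ha.2, hd.2]
  · simp only [Complex.conj_im]
    linarith [h11.2, ha.2, hd.2]

/-- **`2 × 2` Gram positivity.** If `|α|² a + α β̄ b + β ᾱ c + |β|² d ≥ 0` in `ℂ` for all
`α β : ℂ`, then `a ≥ 0`, `d ≥ 0` and `|b|², |c|² ≤ (re a)(re d)`. -/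
theorem gram_two {a b c d : ℂ}
    (h : ∀ α β : ℂ, 0 ≤ α * conj α * a + α * conj β * b + β * conj α * c + β * conj β * d) :
    0 ≤ a ∧ 0 ≤ d ∧ ‖b‖ ^ 2 ≤ a.re * d.re ∧ ‖c‖ ^ 2 ≤ a.re * d.re := by
  have ha0 : 0 ≤ a := by simpa using h 1 0
  have hd0 : 0 ≤ d := by simpa using h 0 1
  have ha := Complex.nonneg_iff.1 ha0
  have hd := Complex.nonneg_iff.1 hd0
  have hc : c = conj b := gram_two_conj h
  -- the real quadratic `r ↦ re a + 2 r |b|² + r² |b|² re d` is non-negative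
  have hq : ∀ r : ℝ, 0 ≤ Complex.normSq b * d.re * (r * r) + 2 * Complex.normSq b * r + a.re := by
    intro r
    have hr := (Complex.nonneg_iff.1 (h 1 (r * b))).1
    have hbb : b * conj b = (Complex.normSq b : ℂ) := Complex.mul_conj b
    have hexp : (1 : ℂ) * conj 1 * a + 1 * conj ((r : ℂ) * b) * b + (r : ℂ) * b * conj 1 * c +
        (r : ℂ) * b * conj ((r : ℂ) * b) * d =
        a + ((2 * Complex.normSq b * r : ℝ) : ℂ) + ((Complex.normSq b * (r * r) : ℝ) : ℂ) * d := by
      rw [hc]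
      simp only [map_one, map_mul, Complex.conj_ofReal, mul_one, one_mul]
      have e1 : (r : ℂ) * conj b * b = ((Complex.normSq b * r : ℝ) : ℂ) := by
        rw [mul_assoc, mul_comm (conj b) b, hbb]; push_cast; ring
      have e2 : (r : ℂ) * b * conj b = ((Complex.normSq b * r : ℝ) : ℂ) := by
        rw [mul_assoc, hbb]; push_cast; ring
      have e3 : (r : ℂ) * b * ((r : ℂ) * conj b) = ((Complex.normSq b * (r * r) : ℝ) : ℂ) := by
        rw [show (r : ℂ) * b * ((r : ℂ) * conj b) = (r : ℂ) * (r : ℂ) * (b * conj b) by ring, hbb]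
        push_cast; ring
      rw [e1, e2, e3]; push_cast; ring
    rw [hexp] at hr
    simp only [Complex.add_re, Complex.ofReal_re, Complex.mul_re, Complex.ofReal_im, zero_mul,
      sub_zero] at hr
    linarith
  have hdisc := discrim_le_zero hq
  rw [discrim] at hdisc
  have hb2 : ‖b‖ ^ 2 = Complex.normSq b := Complex.sq_norm b
  have hkey : ‖b‖ ^ 2 ≤ a.re * d.re := by
    rw [hb2]
    rcases (Complex.normSq_nonneg b).eq_or_lt with h0 | hpos
    · rw [← h0]; exact mul_nonneg ha.1 hd.1
    · nlinarith
  refine ⟨ha0, hd0, hkey, ?_⟩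
  rwa [hc, Complex.norm_conj]

/-- **Rescaled `2 × 2` Gram positivity.** If `v (|α|² a + α β̄ b + β ᾱ c + |β|² d) ≥ 0` in `ℂ` for
all `α β : ℂ` and a fixed `v`, then `v a ≥ 0`, `v d ≥ 0` and `|v b|², |v c|² ≤ re(v a) re(v d)`. -/
theorem gram_two_smul {v a b c d : ℂ}
    (h : ∀ α β : ℂ, 0 ≤ v * (α * conj α * a + α * conj β * b + β * conj α * c + β * conj β * d)) :
    0 ≤ v * a ∧ 0 ≤ v * d ∧ ‖v * b‖ ^ 2 ≤ (v * a).re * (v * d).re ∧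
      ‖v * c‖ ^ 2 ≤ (v * a).re * (v * d).re := by
  refine gram_two fun α β => ?_
  have e : α * conj α * (v * a) + α * conj β * (v * b) + β * conj α * (v * c) + β * conj β * (v * d) =
      v * (α * conj α * a + α * conj β * b + β * conj α * c + β * conj β * d) := by ring
  rw [e]
  exact h α β

/-- From `|x|² ≤ (re p)²`-type Gram bounds to a norm bound: if `0 ≤ p` in `ℂ` and
`‖x‖ ^ 2 ≤ re p * re p` then `‖x‖ ≤ re p`. -/
theorem norm_le_re_of_sq_le {x p : ℂ} (hp : 0 ≤ p) (h : ‖x‖ ^ 2 ≤ p.re * p.re) : ‖x‖ ≤ p.re := by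
  have hp' := (Complex.nonneg_iff.1 hp).1
  rw [← pow_two] at h
  exact (pow_le_pow_iff_left₀ (norm_nonneg x) hp' two_ne_zero).1 h

/-- From the `c₀ · conj`-form of positivity to the normalised form: `0 ≤ c · conj z` implies
`0 ≤ (conj c / ‖c‖) · z`. -/
theorem conj_div_norm_mul_nonneg {c z : ℂ} (h : 0 ≤ c * conj z) : 0 ≤ conj c / (‖c‖ : ℂ) * z := by
  have h1 : 0 ≤ conj c * z := by
    have := star_nonneg_iff.2 h
    simpa [star_mul', mul_comm] using this
  have h2 : (0 : ℂ) ≤ ((‖c‖⁻¹ : ℝ) : ℂ) := Complex.zero_le_real.2 (inv_nonneg.2 (norm_nonneg c))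
  have e : conj c / (‖c‖ : ℂ) * z = ((‖c‖⁻¹ : ℝ) : ℂ) * (conj c * z) := by
    push_cast; ring
  rw [e]
  exact mul_nonneg h2 h1

/-- The normalising phase `conj c / ‖c‖` of a non-zero `c` has modulus one. -/
theorem norm_conj_div_norm {c : ℂ} (hc : c ≠ 0) : ‖conj c / (‖c‖ : ℂ)‖ = 1 := by
  rw [norm_div, Complex.norm_conj, Complex.norm_real, Real.norm_eq_abs, abs_norm, div_self (norm_ne_zero_iff.2 hc)]

/-- Swapping the two summation variables of a symmetrically weighted double sum. -/
theorem sum_sum_mul_swap {ι : Type*} [AddCommGroup ι] (T : Finset ι) (h : ι → ℝ) (N : ι → ℂ) :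
    ∑ z ∈ T, ∑ z' ∈ T, ((h z * h z' : ℝ) : ℂ) * N (z - z') = ∑ z ∈ T, ∑ z' ∈ T, ((h z * h z' : ℝ) : ℂ) * N (z' - z) := by
  rw [Finset.sum_comm]
  exact Finset.sum_congr rfl fun z _ => Finset.sum_congr rfl fun z' _ => by rw [mul_comm (h z') (h z)]

end Gram

/-! ### The reflected pairing of two pseudoscalar densities and its smeared Gram form -/

section Pair

/-- **The reflected pairing of two pseudoscalar densities is a translated pion numerator**:
`∫∫ B_fg(x) Θ_T(B_fg(y)) e^{AP} = −∫∫ B_gf(0) B_fg(x − θy) e^{AP}` (reflection of the density, centrality of even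
elements, translation invariance by `−θy`). -/
theorem pair_identity {S : ℕ} {β : ℝ} {mq : Fin Nf → ℝ}
    (hT : (∀ (f g f' g' : Fin Nf) (Γ Γ' : Matrix (Fin 4) (Fin 4) ℂ) (x y u : TorusSite 4 (2 * S + 1)),
      (∫ U : GaugeConfig 4 (2 * S + 1) (Matrix.specialUnitaryGroup (Fin 3) ℂ),
          fermiIntegral (torusBilinear f g x x Γ 1 * torusBilinear f' g' y y Γ' 1 * fermiBoltzmannAP U mq)
        ∂(wilsonMeasure (fundamentalRep (Fin 3)) β)) =
      ∫ U : GaugeConfig 4 (2 * S + 1) (Matrix.specialUnitaryGroup (Fin 3) ℂ),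
          fermiIntegral (torusBilinear f g (x + u) (x + u) Γ 1 * torusBilinear f' g' (y + u) (y + u) Γ' 1 *
            fermiBoltzmannAP U mq)
        ∂(wilsonMeasure (fundamentalRep (Fin 3)) β)))
    (f g : Fin Nf) (x y : TorusSite 4 (2 * S + 1)) :
    ∫ V : GaugeConfig 4 (2 * S + 1) (Matrix.specialUnitaryGroup (Fin 3) ℂ), fermiIntegral (torusBilinear f g x x gammaFive 1 *
        torusTheta (torusBilinear f g y y gammaFive 1) * fermiBoltzmannAP V mq) ∂(wilsonMeasure (fundamentalRep (Fin 3)) β) =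
      -∫ V : GaugeConfig 4 (2 * S + 1) (Matrix.specialUnitaryGroup (Fin 3) ℂ), fermiIntegral
          (torusBilinear g f (Torus.proj (2 * S + 1) 0) (Torus.proj (2 * S + 1) 0) gammaFive 1 *
            torusBilinear f g (x - Site.negReflect y) (x - Site.negReflect y) gammaFive 1 * fermiBoltzmannAP V mq)
        ∂(wilsonMeasure (fundamentalRep (Fin 3)) β) := by
  -- `proj 0 = 0` (also landed as `VonMisesCirclesC1.c1_proj_zero` in a heavier module; kept local here)
  have h0 : Torus.proj (2 * S + 1) (0 : Site 4) = 0 := by funext i; simp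
  rw [torusTheta_torusBilinear_gammaFive]
  simp only [mul_neg, neg_mul, map_neg, integral_neg, neg_inj]
  rw [mul_torusBilinear_comm g f (Site.negReflect y) (Site.negReflect y) gammaFive 1 (torusBilinear f g x x gammaFive 1),
    hT g f f g gammaFive gammaFive (Site.negReflect y) x (-Site.negReflect y), add_neg_cancel, ← sub_eq_add_neg, h0]

/-- Site arithmetic: `(s e₀ + z) − θ(t e₀ + z') = (s + t) e₀ + (z − z')` on the torus, for `z'` spatial. -/
theorem proj_sub_negReflect_proj (L s t : ℕ) (z z' : Site 4) (hz' : z' 0 = 0) :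
    Torus.proj L (Pi.single 0 (s : ℤ) + z) - Site.negReflect (Torus.proj L (Pi.single 0 (t : ℤ) + z')) =
      Torus.proj L (Pi.single 0 ((s + t : ℕ) : ℤ) + (z - z')) := by
  funext i
  by_cases hi : i = 0
  · subst hi
    simp [hz']
    ring
  · simp [WilsonSiteRP.negReflect_apply_of_ne _ hi, hi]

/-- **Evaluation of the smeared reflected pairing**: for finite real linear combinations
`x₁ = Σ_i a_i B_fg(p_i)`, `x₂ = Σ_j b_j B_fg(q_j)` of pseudoscalar densities,
`∫∫ x₁ Θ_T(x₂) e^{AP} = −Σ_{i,j} a_i b_j ∫∫ B_gf(0) B_fg(p_i − θq_j) e^{AP}`. -/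
theorem pairing_smeared_eq {S : ℕ} {β : ℝ} {mq : Fin Nf → ℝ}
    (hT : (∀ (f g f' g' : Fin Nf) (Γ Γ' : Matrix (Fin 4) (Fin 4) ℂ) (x y u : TorusSite 4 (2 * S + 1)),
      (∫ U : GaugeConfig 4 (2 * S + 1) (Matrix.specialUnitaryGroup (Fin 3) ℂ),
          fermiIntegral (torusBilinear f g x x Γ 1 * torusBilinear f' g' y y Γ' 1 * fermiBoltzmannAP U mq)
        ∂(wilsonMeasure (fundamentalRep (Fin 3)) β)) =
      ∫ U : GaugeConfig 4 (2 * S + 1) (Matrix.specialUnitaryGroup (Fin 3) ℂ),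
          fermiIntegral (torusBilinear f g (x + u) (x + u) Γ 1 * torusBilinear f' g' (y + u) (y + u) Γ' 1 *
            fermiBoltzmannAP U mq)
        ∂(wilsonMeasure (fundamentalRep (Fin 3)) β)))
    (f g : Fin Nf)
    {ι κ : Type*} (s : Finset ι) (t : Finset κ) (a : ι → ℝ) (b : κ → ℝ)
    (p : ι → TorusSite 4 (2 * S + 1)) (q : κ → TorusSite 4 (2 * S + 1)) :
    ∫ V : GaugeConfig 4 (2 * S + 1) (Matrix.specialUnitaryGroup (Fin 3) ℂ), fermiIntegral
        ((∑ i ∈ s, (a i : ℂ) • torusBilinear f g (p i) (p i) gammaFive 1) *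
          torusTheta (∑ j ∈ t, (b j : ℂ) • torusBilinear f g (q j) (q j) gammaFive 1) * fermiBoltzmannAP V mq)
        ∂(wilsonMeasure (fundamentalRep (Fin 3)) β) =
      -∑ i ∈ s, ∑ j ∈ t, ((a i * b j : ℝ) : ℂ) *
        ∫ V : GaugeConfig 4 (2 * S + 1) (Matrix.specialUnitaryGroup (Fin 3) ℂ), fermiIntegral
          (torusBilinear g f (Torus.proj (2 * S + 1) 0) (Torus.proj (2 * S + 1) 0) gammaFive 1 *
            torusBilinear f g (p i - Site.negReflect (q j)) (p i - Site.negReflect (q j)) gammaFive 1 *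
              fermiBoltzmannAP V mq) ∂(wilsonMeasure (fundamentalRep (Fin 3)) β) := by
  have hΘ : torusTheta (∑ j ∈ t, (b j : ℂ) • torusBilinear f g (q j) (q j) gammaFive 1) =
      ∑ j ∈ t, (b j : ℂ) • torusTheta (torusBilinear (Nf := Nf) f g (q j) (q j) gammaFive 1) := by
    rw [map_sum]
    simp only [torusTheta_smul', Complex.conj_ofReal]
  rw [hΘ, integral_fermiIntegral_sum_mul_sum]
  simp only [pair_identity hT, mul_neg, Finset.sum_neg_distrib, Complex.ofReal_mul]

/-- **The smeared Gram form.** For two finite real linear combinations `F₁ = Σ_i a_i (ψ̄_f γ₅ ψ_g)(p_i)`,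
`F₂ = Σ_j b_j (ψ̄_f γ₅ ψ_g)(q_j)` of pseudoscalar densities at box sites of times `≥ 1` (box radius `S`), site
reflection positivity of `α F₁ + β' F₂` gives, with `x_k` the placed `F_k`, `Q(x, y) = ∫∫ x Θ_T(y) e^{AP}` and the
unit phase `v = conj c₀ / ‖c₀‖`:
`0 ≤ v (|α|² Q(x₁,x₁) + α conj β' Q(x₁,x₂) + β' conj α Q(x₂,x₁) + |β'|² Q(x₂,x₂))` for all `α, β'`. -/
theorem gram_input_smeared {S : ℕ} (hS : 1 ≤ S) (mq : Fin Nf → ℝ) (hm : ∀ f, -1 < mq f) {β : ℝ} (hβ : 0 ≤ β)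
    {cN : ℂ} (hcN : fermiThetaRot (GrassmannAlgebra.grassmannBasis ℂ _ (posGens Nf (2 * S + 1))) =
      cN • GrassmannAlgebra.grassmannBasis ℂ _ (negGens Nf (2 * S + 1)))
    (f g : Fin Nf) {ι κ : Type*} (s : Finset ι) (t : Finset κ) (a : ι → ℝ) (b : κ → ℝ)
    (p : ι → ↥(box 4 S)) (q : κ → ↥(box 4 S)) (hp : ∀ i ∈ s, 1 ≤ (p i : Site 4) 0)
    (hq : ∀ j ∈ t, 1 ≤ (q j : Site 4) 0) (α β' : ℂ) :
    0 ≤ conj (posConst (Nf := Nf) (L := 2 * S + 1) cN) / (‖posConst (Nf := Nf) (L := 2 * S + 1) cN‖ : ℂ) *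
      (α * conj α * ∫ V : GaugeConfig 4 (2 * S + 1) (Matrix.specialUnitaryGroup (Fin 3) ℂ), fermiIntegral
          ((∑ i ∈ s, (a i : ℂ) • torusBilinear f g (Torus.proj (2 * S + 1) (p i)) (Torus.proj (2 * S + 1) (p i))
              gammaFive 1) *
            torusTheta (∑ i ∈ s, (a i : ℂ) • torusBilinear f g (Torus.proj (2 * S + 1) (p i))
              (Torus.proj (2 * S + 1) (p i)) gammaFive 1) * fermiBoltzmannAP V mq) ∂(wilsonMeasure (fundamentalRep (Fin 3)) β) +
       α * conj β' * ∫ V : GaugeConfig 4 (2 * S + 1) (Matrix.specialUnitaryGroup (Fin 3) ℂ), fermiIntegral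
          ((∑ i ∈ s, (a i : ℂ) • torusBilinear f g (Torus.proj (2 * S + 1) (p i)) (Torus.proj (2 * S + 1) (p i))
              gammaFive 1) *
            torusTheta (∑ j ∈ t, (b j : ℂ) • torusBilinear f g (Torus.proj (2 * S + 1) (q j))
              (Torus.proj (2 * S + 1) (q j)) gammaFive 1) * fermiBoltzmannAP V mq) ∂(wilsonMeasure (fundamentalRep (Fin 3)) β) +
       β' * conj α * ∫ V : GaugeConfig 4 (2 * S + 1) (Matrix.specialUnitaryGroup (Fin 3) ℂ), fermiIntegral
          ((∑ j ∈ t, (b j : ℂ) • torusBilinear f g (Torus.proj (2 * S + 1) (q j)) (Torus.proj (2 * S + 1) (q j))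
              gammaFive 1) *
            torusTheta (∑ i ∈ s, (a i : ℂ) • torusBilinear f g (Torus.proj (2 * S + 1) (p i))
              (Torus.proj (2 * S + 1) (p i)) gammaFive 1) * fermiBoltzmannAP V mq) ∂(wilsonMeasure (fundamentalRep (Fin 3)) β) +
       β' * conj β' * ∫ V : GaugeConfig 4 (2 * S + 1) (Matrix.specialUnitaryGroup (Fin 3) ℂ), fermiIntegral
          ((∑ j ∈ t, (b j : ℂ) • torusBilinear f g (Torus.proj (2 * S + 1) (q j)) (Torus.proj (2 * S + 1) (q j))
              gammaFive 1) *
            torusTheta (∑ j ∈ t, (b j : ℂ) • torusBilinear f g (Torus.proj (2 * S + 1) (q j))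
              (Torus.proj (2 * S + 1) (q j)) gammaFive 1) * fermiBoltzmannAP V mq) ∂(wilsonMeasure (fundamentalRep (Fin 3)) β)) := by
  -- the two boxed observables and their placing on the torus
  set F₁ : BoxFermiAlg Nf S := ∑ i ∈ s, (a i : ℂ) • boxBilinear f g (p i) (p i) gammaFive 1 with hF₁
  set F₂ : BoxFermiAlg Nf S := ∑ j ∈ t, (b j : ℂ) • boxBilinear f g (q j) (q j) gammaFive 1 with hF₂
  have hx₁ : ExteriorAlgebra.map (placeLin Nf S (2 * S + 1) 0) F₁ =
      ∑ i ∈ s, (a i : ℂ) • torusBilinear f g (Torus.proj (2 * S + 1) (p i)) (Torus.proj (2 * S + 1) (p i))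
        gammaFive 1 := by
    simp only [hF₁, map_sum, map_smul, map_placeLin_boxBilinear, add_zero]
  have hx₂ : ExteriorAlgebra.map (placeLin Nf S (2 * S + 1) 0) F₂ =
      ∑ j ∈ t, (b j : ℂ) • torusBilinear f g (Torus.proj (2 * S + 1) (q j)) (Torus.proj (2 * S + 1) (q j))
        gammaFive 1 := by
    simp only [hF₂, map_sum, map_smul, map_placeLin_boxBilinear, add_zero]
  have hg : ∀ u : Site 4 → (Matrix.specialUnitaryGroup (Fin 3) ℂ), fermiGaugeAct u (α • F₁ + β' • F₂) = α • F₁ + β' • F₂ := fun u => by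
    simp only [hF₁, hF₂, map_add, map_smul, map_sum, fermiGaugeAct_boxBilinear_one]
  have hpos : α • F₁ + β' • F₂ ∈ positiveTimeSubalgebra Nf S := by
    refine add_mem (Subalgebra.smul_mem _ (Subalgebra.sum_mem _ fun i hi => Subalgebra.smul_mem _ ?_ _) _)
      (Subalgebra.smul_mem _ (Subalgebra.sum_mem _ fun j hj => Subalgebra.smul_mem _ ?_ _) _)
    · exact boxBilinear_mem_positiveTimeSubalgebra f g (p i) (p i) gammaFive 1 (hp i hi) (hp i hi)
    · exact boxBilinear_mem_positiveTimeSubalgebra f g (q j) (q j) gammaFive 1 (hq j hj) (hq j hj)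
  have h0 := posConst_mul_conj_integral_nonneg_const hS (α • F₁ + β' • F₂) hg hpos mq hm hβ hcN
  rw [map_add, map_smul, map_smul, hx₁, hx₂, map_add, torusTheta_smul', torusTheta_smul',
    integral_fermiIntegral_pair_expand] at h0
  exact conj_div_norm_mul_nonneg h0

end Pair

/-! ### Registered helper sub-goal -/

/-- **Registered helper sub-goal `stub_transferPositivity_auxGram` of stub `stub_transferPositivity`**: rescaled `2 × 2`
Gram positivity in the complex order (`gram_two_smul`). -/
theorem stub_transferPositivity_auxGram : ∀ {v a b c d : ℂ}, (∀ α β : ℂ, 0 ≤ v * (α * (starRingEnd ℂ) α * a + α * (starRingEnd ℂ) β * b + β * (starRingEnd ℂ) α * c + β * (starRingEnd ℂ) β * d)) → 0 ≤ v * a ∧ 0 ≤ v * d ∧ ‖v * b‖ ^ 2 ≤ (v * a).re * (v * d).re ∧ ‖v * c‖ ^ 2 ≤ (v * a).re * (v * d).re :=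
  fun h => gram_two_smul h

end Summit.QuantumFields.QCD.Cruxes.ChiralOneScaleTrajectory.LogConvexLift.TransferPositivity

end
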